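import Summits.CriticalPhenomena.CardyFormulaZ2.Theorems.CardyBoundaryCoulombGasBoundaryDefectGaussianRStubTransportPathsPart1
import Summits.CriticalPhenomena.CardyFormulaZ2.Theorems.CardyBoundaryCoulombGasRectilinearCardyStubFiniteCorners

/-!
# Stub `stub_transportPaths` of line `rainbow-monomials-in-excursion-kernels` — Part 4:
# closure charts, flat points, finitely many corners, uniform continuity and the tube lemma
# (crux `CardyBoundaryCoulombGas.BoundaryDefectGaussianR`, stmt-CriticalPhenomena-14132)

Continuum bookkeeping around the wedge of Parts 1–3 (`γ = D.boundary`, `p = γ t₀`, frame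
`u = (z - p)(-i)^a`, sector of `m` quadrants):

* `tp_closure_chart` — from the frontier chart (two rays) and the domain chart (open sector) the
  CLOSURE chart follows: within `r` of `p`, `z ∈ closure D` iff `u` lies in the closed sector
  (`m = 1`: `re, im ≥ 0`; `m = 2`: `im ≥ 0`; `m = 3`: `im ≥ 0 ∨ re ≤ 0`). This is what the lattice
  approximation `V_n = {v : δ_n v ∈ closure D}` reads;
* `tp_I_pow_inj` — `i^a = i^b`, `a, b < 4` ⇒ `a = b`;
* `tp_two_of_flat` — a FLAT point (the marks of TRANSPORT: the frontier near `p` is horizontal or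
  vertical) has `m = 2`;
* `tp_finite_nonflat` — all but finitely many parameters of `[0, 1)` are flat
  (`exists_flat_near_of_not_mem_grid` of the tree + injectivity of the loop);
* `tp_unif_cont` — the periodic loop is uniformly continuous;
* `tp_tube` — parameters at cyclic distance `≥ η` have images at distance `≥ c(η) > 0`
  (compactness + injectivity): the tool that converts "the mover does not pass a parked point
  along the boundary" into Euclidean separation.
All [folklore].
-/

noncomputable section

open Set Filter Metric Topology
open Literature.Probability.RandomPlanarGeometry
open Summit.CriticalPhenomena.CardyFormulaZ2.Cruxes.RectilinearCardy.ExcursionKernelCovariance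

namespace Summit.CriticalPhenomena.CardyFormulaZ2.Cruxes.BoundaryDefectGaussianR.RainbowMonomialsInExcursionKernels

/-! ### The closure chart -/

/-- Real bookkeeping for the closure chart, one quadrant. [folklore] -/
theorem tp_closedSec_one (x y : ℝ) :
    ((0 < x ∧ 0 < y) ∨ (y = 0 ∧ 0 ≤ x) ∨ (-x = 0 ∧ 0 ≤ y)) ↔ (0 ≤ x ∧ 0 ≤ y) := by
  constructor
  · rintro (⟨h1, h2⟩ | ⟨h1, h2⟩ | ⟨h1, h2⟩) <;> constructor <;> linarith
  · rintro ⟨h1, h2⟩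
    rcases h1.lt_or_eq with h1 | h1
    · rcases h2.lt_or_eq with h2 | h2
      · exact Or.inl ⟨h1, h2⟩
      · exact Or.inr (Or.inl ⟨h2.symm, h1.le⟩)
    · exact Or.inr (Or.inr ⟨by linarith, h2⟩)

/-- Real bookkeeping for the closure chart, two quadrants. [folklore] -/
theorem tp_closedSec_two (x y : ℝ) :
    ((0 < y) ∨ (y = 0 ∧ 0 ≤ x) ∨ (-y = 0 ∧ 0 ≤ -x)) ↔ 0 ≤ y := by
  constructor
  · rintro (h | ⟨h1, h2⟩ | ⟨h1, h2⟩) <;> linarith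
  · intro h
    rcases h.lt_or_eq with h | h
    · exact Or.inl h
    · by_cases hx : 0 ≤ x
      · exact Or.inr (Or.inl ⟨h.symm, hx⟩)
      · exact Or.inr (Or.inr ⟨by linarith, by linarith⟩)

/-- Real bookkeeping for the closure chart, three quadrants. [folklore] -/
theorem tp_closedSec_three (x y : ℝ) :
    ((0 < y ∨ x < 0) ∨ (y = 0 ∧ 0 ≤ x) ∨ (x = 0 ∧ 0 ≤ -y)) ↔ (0 ≤ y ∨ x ≤ 0) := by
  constructor
  · rintro ((h | h) | ⟨h1, h2⟩ | ⟨h1, h2⟩)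
    · exact Or.inl h.le
    · exact Or.inr h.le
    · exact Or.inl h1.ge
    · exact Or.inr h1.le
  · rintro (h | h)
    · rcases h.lt_or_eq with h | h
      · exact Or.inl (Or.inl h)
      · by_cases hx : 0 ≤ x
        · exact Or.inr (Or.inl ⟨h.symm, hx⟩)
        · exact Or.inl (Or.inr (by linarith))
    · rcases h.lt_or_eq with h' | h'
      · exact Or.inl (Or.inr h')
      · by_cases hy : 0 < y
        · exact Or.inl (Or.inl hy)
        · exact Or.inr (Or.inr ⟨h', by linarith⟩)

/-- **The closure chart.** If within `r` of `p` the frontier of the Jordan domain `D` is the union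
of the start rays of the frames `a` and `a + m` and the domain is the standard sector of `m`
quadrants of the frame `a` (`m = 1, 2, 3`), then within `r` of `p` the CLOSURE of the domain is
the closed sector: `re u ≥ 0 ∧ im u ≥ 0` (`m = 1`), `im u ≥ 0` (`m = 2`), `im u ≥ 0 ∨ re u ≤ 0`
(`m = 3`), `u = (z - p)(-i)^a`. [folklore] -/
theorem tp_closure_chart (D : JordanDomain) {p : ℂ} {r : ℝ} {a m : ℕ} (hm : m = 1 ∨ m = 2 ∨ m = 3)
    (hfront : ∀ z, dist z p < r → (z ∈ frontier D.carrier ↔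
      (((z - p) * (-Complex.I) ^ a).im = 0 ∧ 0 ≤ ((z - p) * (-Complex.I) ^ a).re) ∨
        (((z - p) * (-Complex.I) ^ (a + m)).im = 0 ∧
          0 ≤ ((z - p) * (-Complex.I) ^ (a + m)).re)))
    (hfirst : ∀ z, dist z p < r → (z ∈ D.carrier ↔
      (m = 1 → 0 < ((z - p) * (-Complex.I) ^ a).re ∧ 0 < ((z - p) * (-Complex.I) ^ a).im) ∧
        (m = 2 → 0 < ((z - p) * (-Complex.I) ^ a).im) ∧
        (m = 3 → 0 < ((z - p) * (-Complex.I) ^ a).im ∨ ((z - p) * (-Complex.I) ^ a).re < 0))) :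
    ∀ z, dist z p < r → (z ∈ closure D.carrier ↔
      (m = 1 → 0 ≤ ((z - p) * (-Complex.I) ^ a).re ∧ 0 ≤ ((z - p) * (-Complex.I) ^ a).im) ∧
        (m = 2 → 0 ≤ ((z - p) * (-Complex.I) ^ a).im) ∧
        (m = 3 → 0 ≤ ((z - p) * (-Complex.I) ^ a).im ∨ ((z - p) * (-Complex.I) ^ a).re ≤ 0)) := by
  intro z hz
  have hcl : z ∈ closure D.carrier ↔ z ∈ D.carrier ∨ z ∈ frontier D.carrier := by
    rw [D.closure_eq, D.range_boundary, mem_union]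
  rw [hcl, hfirst z hz, hfront z hz]
  set u := (z - p) * (-Complex.I) ^ a with hu
  have hu' : (z - p) * (-Complex.I) ^ (a + m) = u * (-Complex.I) ^ m := by
    rw [hu, pow_add, mul_assoc]
  rw [hu']
  rcases hm with rfl | rfl | rfl
  · have e1 : (u * (-Complex.I) ^ 1).re = u.im := by simp
    have e2 : (u * (-Complex.I) ^ 1).im = -u.re := by simp
    rw [e1, e2]
    have key := tp_closedSec_one u.re u.im
    constructor
    · rintro (h | h | h)
      · have h' := key.1 (Or.inl (h.1 rfl))
        exact ⟨fun _ => h', fun h => absurd h (by norm_num), fun h => absurd h (by norm_num)⟩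
      · have h' := key.1 (Or.inr (Or.inl h))
        exact ⟨fun _ => h', fun h => absurd h (by norm_num), fun h => absurd h (by norm_num)⟩
      · have h' := key.1 (Or.inr (Or.inr h))
        exact ⟨fun _ => h', fun h => absurd h (by norm_num), fun h => absurd h (by norm_num)⟩
    · rintro ⟨h1, -, -⟩
      rcases key.2 (h1 rfl) with h | h | h
      · exact Or.inl ⟨fun _ => h, fun h => absurd h (by norm_num), fun h => absurd h (by norm_num)⟩
      · exact Or.inr (Or.inl h)
      · exact Or.inr (Or.inr h)
  · have e1 : (u * (-Complex.I) ^ 2).re = -u.re := by simp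
    have e2 : (u * (-Complex.I) ^ 2).im = -u.im := by simp
    rw [e1, e2]
    have key := tp_closedSec_two u.re u.im
    constructor
    · rintro (h | h | h)
      · have h' := key.1 (Or.inl (h.2.1 rfl))
        exact ⟨fun h => absurd h (by norm_num), fun _ => h', fun h => absurd h (by norm_num)⟩
      · have h' := key.1 (Or.inr (Or.inl h))
        exact ⟨fun h => absurd h (by norm_num), fun _ => h', fun h => absurd h (by norm_num)⟩
      · have h' := key.1 (Or.inr (Or.inr h))
        exact ⟨fun h => absurd h (by norm_num), fun _ => h', fun h => absurd h (by norm_num)⟩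
    · rintro ⟨-, h1, -⟩
      rcases key.2 (h1 rfl) with h | h | h
      · exact Or.inl ⟨fun h => absurd h (by norm_num), fun _ => h, fun h => absurd h (by norm_num)⟩
      · exact Or.inr (Or.inl h)
      · exact Or.inr (Or.inr h)
  · have e1 : (u * (-Complex.I) ^ 3).re = -u.im := by simp [pow_succ]
    have e2 : (u * (-Complex.I) ^ 3).im = u.re := by simp [pow_succ]
    rw [e1, e2]
    have key := tp_closedSec_three u.re u.im
    constructor
    · rintro (h | h | h)
      · have h' := key.1 (Or.inl (h.2.2 rfl))
        exact ⟨fun h => absurd h (by norm_num), fun h => absurd h (by norm_num), fun _ => h'⟩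
      · have h' := key.1 (Or.inr (Or.inl h))
        exact ⟨fun h => absurd h (by norm_num), fun h => absurd h (by norm_num), fun _ => h'⟩
      · have h' := key.1 (Or.inr (Or.inr h))
        exact ⟨fun h => absurd h (by norm_num), fun h => absurd h (by norm_num), fun _ => h'⟩
    · rintro ⟨-, -, h1⟩
      rcases key.2 (h1 rfl) with h | h | h
      · exact Or.inl ⟨fun h => absurd h (by norm_num), fun h => absurd h (by norm_num), fun _ => h⟩
      · exact Or.inr (Or.inl h)
      · exact Or.inr (Or.inr h)

/-! ### Flat points have `m = 2`; finitely many corners -/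

/-- The four axis directions `i^a`, `a < 4`, are distinct. [folklore] -/
theorem tp_I_pow_inj {a b : ℕ} (ha : a < 4) (hb : b < 4) (h : Complex.I ^ a = Complex.I ^ b) :
    a = b := by
  have h1 := congrArg Complex.re h
  have h2 := congrArg Complex.im h
  have h12 := And.intro h1 h2
  interval_cases a <;> interval_cases b <;>
    first | rfl | (exfalso; norm_num [pow_succ] at h12)

/-- **Flat points have two quadrants.** If the germs at `p = γ t₀` run along `i^a` (beyond radius
`r`) and `i^(a+m)` (beyond radius `r`), `m ∈ {1, 2, 3}`, and the frontier near `p` lies on the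
horizontal or on the vertical line through `p` (the flatness hypothesis of TRANSPORT at a mark),
then `m = 2`. [folklore] -/
theorem tp_two_of_flat (D : JordanDomain) {t₀ r η : ℝ} {a m : ℕ} (hr : 0 < r) (hη : 0 < η)
    (ha : a < 4) (hm : m = 1 ∨ m = 2 ∨ m = 3)
    (hdirA : ∀ t ∈ Icc t₀ (t₀ + η), D.boundary t =
      D.boundary t₀ + ((‖D.boundary t - D.boundary t₀‖ : ℝ) : ℂ) * Complex.I ^ a)
    (hrA : r < ‖D.boundary (t₀ + η) - D.boundary t₀‖)
    (hdirB : ∀ t ∈ Icc (t₀ - η) t₀, D.boundary t =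
      D.boundary t₀ + ((‖D.boundary t - D.boundary t₀‖ : ℝ) : ℂ) * Complex.I ^ (a + m))
    (hrB : r < ‖D.boundary (t₀ - η) - D.boundary t₀‖)
    (hflat : ∃ r' : ℝ, 0 < r' ∧
      ((∀ z ∈ frontier D.carrier, dist z (D.boundary t₀) < r' → z.im = (D.boundary t₀).im) ∨
        (∀ z ∈ frontier D.carrier, dist z (D.boundary t₀) < r' → z.re = (D.boundary t₀).re))) :
    m = 2 := by
  set γ := D.boundary with hγ
  set p := γ t₀ with hp
  have hγc : Continuous γ := D.continuous_boundary
  obtain ⟨r', hr', hfl⟩ := hflat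
  have hM : 0 < min r r' := lt_min hr hr'
  set s := min r r' / 2 with hs
  have hs0 : 0 < s := by rw [hs]; linarith
  have hsr : s < r := by rw [hs]; linarith [min_le_left r r']
  have hsr' : s < r' := by rw [hs]; linarith [min_le_right r r']
  obtain ⟨t₁, -, ht₁⟩ :=
    exists_mem_Icc_eq_of_norm_le' hγc (by linarith) hdirA rfl hs0.le (by linarith)
  obtain ⟨t₂, -, ht₂⟩ :=
    exists_mem_Icc_eq_of_norm_le hγc (by linarith) hdirB rfl hs0.le (by linarith)
  have hd : ∀ b : ℕ, dist (p + (s : ℂ) * Complex.I ^ b) p < r' := fun b => by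
    rw [dist_eq_norm, add_sub_cancel_left, norm_mul, norm_pow, Complex.norm_I, one_pow, mul_one,
      Complex.norm_real, Real.norm_eq_abs, abs_of_pos hs0]
    exact hsr'
  have hf₁ : p + (s : ℂ) * Complex.I ^ a ∈ frontier D.carrier := by
    rw [← ht₁]; exact D.boundary_mem_frontier t₁
  have hf₂ : p + (s : ℂ) * Complex.I ^ (a + m) ∈ frontier D.carrier := by
    rw [← ht₂]; exact D.boundary_mem_frontier t₂
  have key : ((Complex.I ^ a).im = 0 ∧ (Complex.I ^ a * Complex.I ^ m).im = 0) ∨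
      ((Complex.I ^ a).re = 0 ∧ (Complex.I ^ a * Complex.I ^ m).re = 0) := by
    rw [← pow_add]
    rcases hfl with h | h
    · left
      have h1 := h _ hf₁ (hd a)
      have h2 := h _ hf₂ (hd (a + m))
      simp only [Complex.add_im, Complex.mul_im, Complex.ofReal_re, Complex.ofReal_im, zero_mul,
        add_zero, add_eq_left] at h1 h2
      exact ⟨(mul_eq_zero.1 h1).resolve_left hs0.ne', (mul_eq_zero.1 h2).resolve_left hs0.ne'⟩
    · right
      have h1 := h _ hf₁ (hd a)
      have h2 := h _ hf₂ (hd (a + m))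
      simp only [Complex.add_re, Complex.mul_re, Complex.ofReal_re, Complex.ofReal_im, zero_mul,
        sub_zero, add_eq_left] at h1 h2
      exact ⟨(mul_eq_zero.1 h1).resolve_left hs0.ne', (mul_eq_zero.1 h2).resolve_left hs0.ne'⟩
  rcases hm with rfl | rfl | rfl
  · exfalso
    interval_cases a <;> norm_num [pow_succ] at key
  · rfl
  · exfalso
    interval_cases a <;> norm_num [pow_succ] at key

/-- **Finitely many corners.** For a Jordan domain whose frontier is covered by finitely many
axis-parallel segments, all but finitely many parameters `t ∈ [0,1)` are flat: near `γ t` the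
frontier lies on the horizontal or on the vertical line through `γ t` (non-flat images are grid
points of the cover, and the loop is injective on `[0,1)`). [folklore] -/
theorem tp_finite_nonflat (D : JordanDomain) {S : Finset (ℂ × ℂ)}
    (hS : ∀ p ∈ S, p.1.re = p.2.re ∨ p.1.im = p.2.im)
    (hcov : frontier D.carrier ⊆ ⋃ p ∈ S, segment ℝ p.1 p.2) :
    {t : ℝ | t ∈ Ico (0 : ℝ) 1 ∧ ¬ ∃ r : ℝ, 0 < r ∧
      ((∀ z ∈ frontier D.carrier, dist z (D.boundary t) < r → z.im = (D.boundary t).im) ∨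
        (∀ z ∈ frontier D.carrier, dist z (D.boundary t) < r →
          z.re = (D.boundary t).re))}.Finite := by
  classical
  set G : Finset ℂ := (S ×ˢ S).image fun pq : (ℂ × ℂ) × (ℂ × ℂ) => (⟨pq.2.1.re, pq.1.1.im⟩ : ℂ)
    with hG
  have hfin : (Ico (0 : ℝ) 1 ∩ D.boundary ⁻¹' (↑G : Set ℂ)).Finite :=
    Set.Finite.of_finite_image (G.finite_toSet.subset (image_subset_iff.2 fun s hs => hs.2))
      (D.injOn_boundary.mono inter_subset_left)
  refine hfin.subset ?_
  rintro t ⟨ht, hnot⟩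
  refine ⟨ht, ?_⟩
  by_contra hGt
  exact hnot (exists_flat_near_of_not_mem_grid hS hcov hGt)

/-! ### Uniform continuity and the tube lemma -/

/-- **The boundary loop is uniformly continuous** (continuous and periodic). [folklore] -/
theorem tp_unif_cont (D : JordanDomain) {ε : ℝ} (hε : 0 < ε) :
    ∃ δ : ℝ, 0 < δ ∧ ∀ s t : ℝ, |s - t| < δ → dist (D.boundary s) (D.boundary t) < ε := by
  have hK : IsCompact (Icc (-1 : ℝ) 2) := isCompact_Icc
  have huc := hK.uniformContinuousOn_of_continuous D.continuous_boundary.continuousOn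
  rw [Metric.uniformContinuousOn_iff] at huc
  obtain ⟨δ, hδ, h⟩ := huc ε hε
  refine ⟨min δ 1, lt_min hδ one_pos, fun s t hst => ?_⟩
  have hδ' : |s - t| < δ := lt_of_lt_of_le hst (min_le_left _ _)
  have h1' : |s - t| < 1 := lt_of_lt_of_le hst (min_le_right _ _)
  set n := ⌊s⌋ with hn
  have hs' : D.boundary (s - n * 1) = D.boundary s := D.periodic_boundary.sub_int_mul_eq n
  have ht' : D.boundary (t - n * 1) = D.boundary t := D.periodic_boundary.sub_int_mul_eq n
  rw [mul_one] at hs' ht'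
  rw [← hs', ← ht']
  have hs1 : (n : ℝ) ≤ s := Int.floor_le s
  have hs2 : s < n + 1 := Int.lt_floor_add_one s
  have hst' := abs_lt.1 h1'
  refine h (s - n) ⟨by linarith, by linarith⟩ (t - n) ⟨by linarith, by linarith⟩ ?_
  rw [Real.dist_eq, sub_sub_sub_cancel_right]
  exact hδ'

/-- **The tube lemma.** For `0 < η ≤ 1/2` there is `c > 0` such that any two parameters whose
difference is at distance `≥ η` from every integer have images at distance `≥ c` (the distance
function is continuous and positive on a compact parameter set, by injectivity of the loop on
windows of length `1`). [folklore] -/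
theorem tp_tube (D : JordanDomain) {η : ℝ} (hη : 0 < η) (hη2 : η ≤ 1 / 2) :
    ∃ c : ℝ, 0 < c ∧ ∀ s t : ℝ, (∀ n : ℤ, η ≤ |s - t - n|) →
      c ≤ dist (D.boundary s) (D.boundary t) := by
  set γ := D.boundary with hγ
  have hγc : Continuous γ := D.continuous_boundary
  set K : Set (ℝ × ℝ) := (fun q : ℝ × ℝ => (q.1, q.1 + q.2)) '' (Icc (0 : ℝ) 1 ×ˢ Icc η (1 - η))
    with hK
  have hKc : IsCompact K := (isCompact_Icc.prod isCompact_Icc).image (by fun_prop)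
  have hKne : K.Nonempty :=
    ⟨((0 : ℝ), (0 : ℝ) + η), ⟨((0 : ℝ), η), ⟨⟨le_rfl, zero_le_one⟩, ⟨le_rfl, by linarith⟩⟩, rfl⟩⟩
  set F : ℝ × ℝ → ℝ := fun q => dist (γ q.1) (γ q.2) with hF
  have hFc : Continuous F := by
    have h1 : Continuous fun q : ℝ × ℝ => γ q.1 := hγc.comp continuous_fst
    have h2 : Continuous fun q : ℝ × ℝ => γ q.2 := hγc.comp continuous_snd
    exact h1.dist h2
  obtain ⟨q₀, hq₀K, hmin⟩ := hKc.exists_isMinOn hKne hFc.continuousOn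
  have hpos : 0 < F q₀ := by
    obtain ⟨⟨s, u⟩, ⟨-, hu⟩, rfl⟩ := hq₀K
    change 0 < dist (γ s) (γ (s + u))
    rw [dist_pos]
    intro h
    have := tp_injOn_Ico D s ⟨le_rfl, by linarith⟩ ⟨by linarith [hu.1], by linarith [hu.2]⟩ h
    linarith [hu.1]
  refine ⟨F q₀, hpos, fun s t hst => ?_⟩
  -- reduce `(s, t)` into `K` using periodicity
  set n := ⌊s⌋ with hn
  set k := ⌊t - s⌋ with hk
  set u := t - s - k with hu
  have hu0 : 0 ≤ u := by have := Int.floor_le (t - s); rw [hu]; linarith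
  have hu1 : u < 1 := by have := Int.lt_floor_add_one (t - s); rw [hu]; linarith
  have huη : η ≤ u := by
    have h := hst (-k)
    have : s - t - ((-k : ℤ) : ℝ) = -u := by rw [hu]; push_cast; ring
    rw [this, abs_neg, abs_of_nonneg hu0] at h
    exact h
  have huη' : u ≤ 1 - η := by
    have h := hst (-k - 1)
    have : s - t - ((-k - 1 : ℤ) : ℝ) = 1 - u := by rw [hu]; push_cast; ring
    rw [this, abs_of_nonneg (by linarith)] at h
    linarith
  have hs0 : 0 ≤ s - n := by have := Int.floor_le s; linarith
  have hs1 : s - n < 1 := by have := Int.lt_floor_add_one s; linarith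
  have hmem : (s - n, s - n + u) ∈ K :=
    ⟨(s - n, u), ⟨⟨hs0, hs1.le⟩, ⟨huη, huη'⟩⟩, rfl⟩
  have hle : F q₀ ≤ F (s - n, s - n + u) := (isMinOn_iff.1 hmin) _ hmem
  have h1 : γ (s - n) = γ s := by
    have := D.periodic_boundary.sub_int_mul_eq n (x := s)
    rwa [mul_one] at this
  have h2 : γ (s - n + u) = γ t := by
    have := D.periodic_boundary.sub_int_mul_eq (n + k) (x := t)
    rw [mul_one] at this
    have e : s - n + u = t - ((n + k : ℤ) : ℝ) := by rw [hu]; push_cast; ring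
    rw [e]; exact this
  calc F q₀ ≤ F (s - n, s - n + u) := hle
    _ = dist (γ s) (γ t) := by simp only [hF, h1, h2]

/-- **Registered sub-goal `s7_tube` of stub `stub_transportPaths`** (the tube lemma, one-line form
of `tp_tube`). [folklore] -/
theorem s7_tube : ∀ (D : Literature.Probability.RandomPlanarGeometry.JordanDomain) (η : ℝ), 0 < η → η ≤ 1 / 2 → ∃ c : ℝ, 0 < c ∧ ∀ s t : ℝ, (∀ n : ℤ, η ≤ |s - t - n|) → c ≤ dist (D.boundary s) (D.boundary t) :=
  fun D _ hη hη2 => tp_tube D hη hη2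

end Summit.CriticalPhenomena.CardyFormulaZ2.Cruxes.BoundaryDefectGaussianR.RainbowMonomialsInExcursionKernels

end
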